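import Literature.MathematicalPhysics.QuantumFieldTheory.Balaban1983to89.B9Eq373DerivativeRemainderL2
import Literature.MathematicalPhysics.QuantumFieldTheory.Balaban1983to89.B11Eq103H1Complex

/-!
# `Balaban1983to89.B9Eq3126GreenLetters` — T. Bałaban, *Propagators for lattice gauge theories in a background field*, Commun. Math. Phys. **99**
# (1985) 389–434 [Balaban1985BackgroundPropagators] (3.126) p. 420 *«HB = GQ*(QGQ*)⁻¹B»*, (3.147)/(3.153) pp. 425–426 (`𝔓`, `𝔊 = G𝔓*`) and
# [Balaban1985Variational] (45) p. 285 / (110)–(111) p. 294: OPERATOR BOUNDS OF `G₁ = Δ_a⁻¹`, `(QG₁Q*)⁻¹`, `H₁`, `𝔊` FROM A COERCIVITY CONSTANT,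
# AN OPERATOR BOUND OF `Δ_a` AND A MODULUS OF `Q*` — abstract finite-dimensional `𝕜`-Hilbert letters for the pub-balaban NE9 chain's
# `B11Eq103H1Complex.G1K`/`KinvK`/`H1K` and `B11Eq111FrakG.frakGLin`

statement-level skeleton of published theorems with citation tags; proofs where landed; nothing here is a claim about the Yang–Mills mass gap

PDF held: `paper:balaban1985-cmp99-background-propagators` (journal page = PDF page + 388), pp. 416, 420, 425–426; `paper:balaban1985-cmp102-
variational` pp. 285, 293–294 (via the chain's `B11Eq103H1Complex`/`B11Eq111FrakG` docstrings); read by this seat (2026-08-22).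

THE PRINT (verbatim).  [B9] p. 420, (3.126): *«HB = GQ*(QGQ*)⁻¹B»*; p. 416: *«Theorem 3.11 … the operators Δ′_a, G′, (Q′G′²Q′*)⁻¹, Δ_a, G are positive
definite. This is obvious for the first three operators»*; [B11] p. 294: *«We denote by G₁ an inverse operator to the operator Δ₁ + DRD* + aQ*Q …
the operator G₁𝔓* is equal to the operator 𝔊»*.

WHY THIS FILE (cell context).  The NE9 chain's letters `G₁(U)`, `(QG₁Q*)⁻¹`, `H₁(U)`, `𝔊(U)` are CONSTRUCTED (`B11Eq103H1Complex`, owner gen 77)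
from the positivity of `Δ_a(U)` — now a THEOREM at every small field of a fixed lattice (`B9Thm311SmallFieldClosed`/`Green`, gen 80).  The chart
of the `cur U` species (`Support/NE9CurChartOfBackground`) has radii depending on `‖𝔊(U)‖`, `‖H₁(U)‖`; to control them UNIFORMLY over the
small-field set one needs operator bounds of these letters from quantities that ARE uniform: the coercivity `γ` of `Δ_a`, an operator bound `M`
of `Δ_a`, a bound `M_Q` of `Q` and a modulus `μ_Q` of `Q*`.  This file proves the abstract bounds; `B9Eq3126H1Bound` instantiates them.

WHAT IS PROVED (sorry-free; no `Prop` placeholder; no inequality of the papers asserted).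
* §0 `rePosDef_of_coercive`, **`norm_greenK_le`** (`γ‖x‖² ≤ re⟨x, Tx⟩ ⇒ ‖T⁻¹y‖ ≤ γ⁻¹‖y‖`).
* §1 **`re_inner_G1K_ge`** (`re⟨z, G₁z⟩ ≥ (γ/M²)‖z‖²`), `adjoint_injective_of_modulus`, **`re_inner_K_ge`** (`K = QG₁Q†` is `(γμ_Q²/M²)`-coercive),
  **`norm_KinvK_le`** (`‖(QG₁Q†)⁻¹y‖ ≤ (M²/(γμ_Q²))‖y‖`), **`norm_H1K_le`** (`‖H₁b‖ ≤ γ⁻¹·M_Q·(M²/(γμ_Q²))‖b‖`), **`norm_frakGLin_le`**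
  (`‖𝔊x‖ ≤ γ⁻¹(1 + M_Q²(M²/(γμ_Q²))γ⁻¹ + M_D²γ⁻¹)‖x‖`).
* §2 **`exists_modulus_of_injective`** (an injective linear map on a finite-dimensional space has a modulus `μ > 0`; compact unit sphere).
MODEL / DECLARED READINGS.  (M1) `E` (bond functions), `F` (block fields) finite-dimensional `𝕜`-Hilbert spaces, `S` (gauge parameters) a
`𝕜`-inner product space; `Δ, D, R, D*, Q, a` the letters of `laplaceAK`; `Q* := Q†`.  (M2) hypotheses: coercivity `γ > 0`, operator bound `M > 0`,
`‖Qx‖ ≤ M_Q‖x‖`, `μ_Q‖y‖ ≤ ‖Q†y‖`, `‖Ds‖, ‖D*x‖ ≤ M_D‖·‖`, `‖Rs‖ ≤ ‖s‖`.  (M3) crude constants (Lax–Milgram bookkeeping); no decay.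
HONEST SCOPE.  [folklore] operator-norm bookkeeping for the chain's OWN constructed letters; NOT summit progress (cell pub-balaban: NE9 NOT PRINTED /
NOT PROVED; spine PROVED 0/9).  Filed by the pub-balaban NE9 BINDER-row owner lineage `b2b-balaban-t4-ne9-p1` (gen 80); NEW file importing
`B11Eq103H1Complex`, `B9Eq373DerivativeRemainderL2` (for `norm_adjoint_apply_le`); nothing modified.  Net new unproved facts: 0.
-/

noncomputable section

open scoped InnerProductSpace ComplexConjugate BigOperators

namespace Literature.MathematicalPhysics.QuantumFieldTheory.Balaban1983to89.B9Eq3126GreenLetters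

open B11Eq103H1Complex (laplaceAK greenK apply_greenK greenK_apply G1K KinvK H1K laplaceAK_G1K)
open B11Eq111FrakG (frakGLin frakPstarLin)
open B9Eq373DerivativeRemainderL2 (norm_adjoint_apply_le)

/-! ## §0 A coercive operator has an inverse bounded by `γ⁻¹` -/

section Green

variable {𝕜 : Type*} [RCLike 𝕜] {E : Type*} [NormedAddCommGroup E] [InnerProductSpace 𝕜 E] [FiniteDimensional 𝕜 E]

omit [FiniteDimensional 𝕜 E] in
/-- coercivity gives positivity (the `hpos` letter of `greenK`). [cite: Balaban1985BackgroundPropagators, Thm 3.11 p.416] -/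
theorem rePosDef_of_coercive {T : E →ₗ[𝕜] E} {γ : ℝ} (hγ : 0 < γ) (hT : ∀ x : E, γ * ‖x‖ ^ 2 ≤ RCLike.re ⟪x, T x⟫_𝕜) (x : E) (hx : x ≠ 0) :
    0 < RCLike.re ⟪x, T x⟫_𝕜 :=
  lt_of_lt_of_le (mul_pos hγ (by positivity)) (hT x)

/-- **`‖T⁻¹y‖ ≤ γ⁻¹‖y‖` FOR A `γ`-COERCIVE `T`** (`γ‖Gy‖² ≤ re⟨Gy, TGy⟩ = re⟨Gy, y⟩ ≤ ‖Gy‖‖y‖`): the operator-norm form of «G = Δ_a⁻¹ is bounded»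
at a fixed lattice. [cite: Balaban1985BackgroundPropagators, Thm 3.4 p.400, Thm 3.11 p.416] -/
theorem norm_greenK_le {T : E →ₗ[𝕜] E} {γ : ℝ} (hγ : 0 < γ) (hT : ∀ x : E, γ * ‖x‖ ^ 2 ≤ RCLike.re ⟪x, T x⟫_𝕜)
    (hpos : ∀ x : E, x ≠ 0 → 0 < RCLike.re ⟪x, T x⟫_𝕜) (y : E) : ‖greenK T hpos y‖ ≤ γ⁻¹ * ‖y‖ := by
  have h1 : γ * ‖greenK T hpos y‖ ^ 2 ≤ ‖greenK T hpos y‖ * ‖y‖ := by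
    calc γ * ‖greenK T hpos y‖ ^ 2 ≤ RCLike.re ⟪greenK T hpos y, T (greenK T hpos y)⟫_𝕜 := hT _
      _ = RCLike.re ⟪greenK T hpos y, y⟫_𝕜 := by rw [apply_greenK hpos]
      _ ≤ ‖greenK T hpos y‖ * ‖y‖ := re_inner_le_norm _ _
  rw [inv_mul_eq_div, le_div_iff₀ hγ]
  rcases eq_or_lt_of_le (norm_nonneg (greenK T hpos y)) with h0 | hpos'
  · rw [← h0, zero_mul]; positivity
  · have : γ * ‖greenK T hpos y‖ * ‖greenK T hpos y‖ ≤ ‖y‖ * ‖greenK T hpos y‖ := by nlinarith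
    have := le_of_mul_le_mul_right this hpos'
    linarith

end Green

/-! ## §1 Abstract: bounds of `G₁`, `(QG₁Q*)⁻¹`, `H₁ = G₁Q*(QG₁Q*)⁻¹`, `𝔊 = G₁𝔓*` from a coercivity constant, an operator bound and a modulus of `Q*` -/

section Abstract

variable {𝕜 : Type*} [RCLike 𝕜] {E : Type*} [NormedAddCommGroup E] [InnerProductSpace 𝕜 E] [FiniteDimensional 𝕜 E]
  {F : Type*} [NormedAddCommGroup F] [InnerProductSpace 𝕜 F] [FiniteDimensional 𝕜 F] {S : Type*} [NormedAddCommGroup S] [InnerProductSpace 𝕜 S]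
  {Δ : E →ₗ[𝕜] E} {D : S →ₗ[𝕜] E} {R : S →ₗ[𝕜] S} {Dstar : E →ₗ[𝕜] S} {Q : E →ₗ[𝕜] F} {a : 𝕜}
  {γ MT : ℝ} (hγ : 0 < γ)
  (hcoer : ∀ x : E, γ * ‖x‖ ^ 2 ≤ RCLike.re ⟪x, laplaceAK Δ D R Dstar Q (LinearMap.adjoint Q) a x⟫_𝕜)
  (hMT : ∀ x : E, ‖laplaceAK Δ D R Dstar Q (LinearMap.adjoint Q) a x‖ ≤ MT * ‖x‖)
  (hpos : ∀ x : E, x ≠ 0 → 0 < RCLike.re ⟪x, laplaceAK Δ D R Dstar Q (LinearMap.adjoint Q) a x⟫_𝕜)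

include hγ hcoer hMT in
/-- **`G₁ = Δ_a⁻¹` IS COERCIVE: `re⟨z, G₁z⟩ ≥ (γ/M²)‖z‖²`** when `Δ_a` is `γ`-coercive with operator bound `M` (`w = G₁z`: `re⟨z, w⟩ = re⟨Δ_a w, w⟩ ≥
γ‖w‖² ≥ γ‖z‖²/M²`). [cite: Balaban1985BackgroundPropagators, Thm 3.11 p.416; Balaban1985Variational, (110) p.294] -/
theorem re_inner_G1K_ge (z : E) : γ / MT ^ 2 * ‖z‖ ^ 2 ≤ RCLike.re ⟪z, G1K Δ D R Dstar Q (LinearMap.adjoint Q) a hpos z⟫_𝕜 := by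
  set w := G1K Δ D R Dstar Q (LinearMap.adjoint Q) a hpos z with hw
  have hz : laplaceAK Δ D R Dstar Q (LinearMap.adjoint Q) a w = z := laplaceAK_G1K hpos z
  have h1 : RCLike.re ⟪z, w⟫_𝕜 = RCLike.re ⟪w, laplaceAK Δ D R Dstar Q (LinearMap.adjoint Q) a w⟫_𝕜 := by
    rw [hz, ← inner_conj_symm, RCLike.conj_re]
  rw [h1]
  have h2 : ‖z‖ ≤ MT * ‖w‖ := by rw [← hz]; exact hMT w
  have hMT0 : 0 ≤ MT * ‖w‖ := (norm_nonneg _).trans h2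
  by_cases hM : MT = 0
  · rw [hM]; simp only [ne_eq, OfNat.ofNat_ne_zero, not_false_eq_true, zero_pow, div_zero, zero_mul]
    exact le_trans (by positivity) (hcoer w)
  · have hMpos : 0 < MT ^ 2 := by positivity
    have h3 : ‖z‖ ^ 2 ≤ MT ^ 2 * ‖w‖ ^ 2 := by
      rw [← mul_pow]; exact pow_le_pow_left₀ (norm_nonneg _) h2 2
    calc γ / MT ^ 2 * ‖z‖ ^ 2 ≤ γ / MT ^ 2 * (MT ^ 2 * ‖w‖ ^ 2) := mul_le_mul_of_nonneg_left h3 (by positivity)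
      _ = γ * ‖w‖ ^ 2 := by field_simp
      _ ≤ _ := hcoer w

variable {MQ μQ : ℝ} (hMQ : 0 ≤ MQ) (hμQ : 0 < μQ) (hQ : ∀ x : E, ‖Q x‖ ≤ MQ * ‖x‖) (hQadj : ∀ y : F, μQ * ‖y‖ ≤ ‖LinearMap.adjoint Q y‖)
  (hadj : ∀ (x : E) (y : F), ⟪Q x, y⟫_𝕜 = ⟪x, LinearMap.adjoint Q y⟫_𝕜) (hinj : Function.Injective (LinearMap.adjoint Q))

include hμQ hQadj in
/-- a modulus of `Q†` makes it injective. [cite: Balaban1985BackgroundPropagators, (3.19) p.393] -/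
theorem adjoint_injective_of_modulus : Function.Injective (LinearMap.adjoint Q) := by
  intro y y' h
  have h1 : μQ * ‖y - y'‖ ≤ ‖LinearMap.adjoint Q (y - y')‖ := hQadj _
  rw [map_sub, h, sub_self, norm_zero] at h1
  have : ‖y - y'‖ ≤ 0 := by nlinarith [norm_nonneg (y - y')]
  exact sub_eq_zero.1 (norm_le_zero_iff.1 this)

include hγ hcoer hMT hμQ hQadj in
/-- **`K = QG₁Q†` IS COERCIVE: `re⟨y, Ky⟩ ≥ (γμ_Q²/M²)‖y‖²`.** [cite: Balaban1985BackgroundPropagators, Thm 3.11 p.416; Balaban1985Variational, (45) p.285] -/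
theorem re_inner_K_ge (y : F) :
    γ * μQ ^ 2 / MT ^ 2 * ‖y‖ ^ 2 ≤ RCLike.re ⟪y, (Q ∘ₗ G1K Δ D R Dstar Q (LinearMap.adjoint Q) a hpos ∘ₗ LinearMap.adjoint Q) y⟫_𝕜 := by
  rw [LinearMap.comp_apply, LinearMap.comp_apply, ← LinearMap.adjoint_inner_left]
  have h1 := re_inner_G1K_ge hγ hcoer hMT hpos (LinearMap.adjoint Q y)
  have h2 : μQ ^ 2 * ‖y‖ ^ 2 ≤ ‖LinearMap.adjoint Q y‖ ^ 2 := by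
    rw [← mul_pow]; exact pow_le_pow_left₀ (by positivity) (hQadj y) 2
  calc γ * μQ ^ 2 / MT ^ 2 * ‖y‖ ^ 2 = γ / MT ^ 2 * (μQ ^ 2 * ‖y‖ ^ 2) := by ring
    _ ≤ γ / MT ^ 2 * ‖LinearMap.adjoint Q y‖ ^ 2 := mul_le_mul_of_nonneg_left h2 (by positivity)
    _ ≤ _ := h1

include hγ hcoer hMT hμQ hQadj in
/-- **`‖(QG₁Q†)⁻¹ y‖ ≤ (M²/(γμ_Q²))‖y‖`** (for an operator bound `M > 0`). [cite: Balaban1985Variational, (45) p.285; Balaban1985BackgroundPropagators, Thm 3.11 p.416] -/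
theorem norm_KinvK_le (hMT0 : 0 < MT) (y : F) :
    ‖KinvK (Δ := Δ) (D := D) (R := R) (Dstar := Dstar) (Q := Q) (Qadj := LinearMap.adjoint Q) (a := a) hpos hadj hinj y‖ ≤
      (γ * μQ ^ 2 / MT ^ 2)⁻¹ * ‖y‖ := by
  unfold KinvK
  exact norm_greenK_le (by positivity) (re_inner_K_ge hγ hcoer hMT hpos hμQ hQadj) _ y

include hγ hcoer hMT hMQ hμQ hQ hQadj in
/-- **`‖H₁ b‖ ≤ γ⁻¹·M_Q·(M²/(γμ_Q²))·‖b‖`** for `H₁ = G₁Q†(QG₁Q†)⁻¹` ((45)/(103)): `‖G₁‖ ≤ γ⁻¹`, `‖Q†‖ ≤ M_Q` (adjoint transfer), the previous bound.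
[cite: Balaban1985Variational, (45) p.285, (103) p.293; Balaban1985BackgroundPropagators, (3.126) p.420] -/
theorem norm_H1K_le (hMT0 : 0 < MT) (b : F) :
    ‖H1K (Δ := Δ) (D := D) (R := R) (Dstar := Dstar) (Q := Q) (Qadj := LinearMap.adjoint Q) (a := a) hpos hadj hinj b‖ ≤
      γ⁻¹ * MQ * (γ * μQ ^ 2 / MT ^ 2)⁻¹ * ‖b‖ := by
  unfold H1K
  rw [LinearMap.comp_apply, LinearMap.comp_apply]
  have h1 := norm_greenK_le hγ hcoer hpos (LinearMap.adjoint Q (KinvK hpos hadj hinj b))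
  have h2 := norm_adjoint_apply_le Q hMQ hQ (KinvK hpos hadj hinj b)
  have h3 := norm_KinvK_le hγ hcoer hMT hpos hμQ hQadj hadj hinj hMT0 b
  have hK0 : 0 ≤ (γ * μQ ^ 2 / MT ^ 2)⁻¹ := by positivity
  unfold G1K
  calc _ ≤ γ⁻¹ * ‖LinearMap.adjoint Q (KinvK hpos _ _ b)‖ := h1
    _ ≤ γ⁻¹ * (MQ * ‖KinvK hpos _ _ b‖) := mul_le_mul_of_nonneg_left h2 (by positivity)
    _ ≤ γ⁻¹ * (MQ * ((γ * μQ ^ 2 / MT ^ 2)⁻¹ * ‖b‖)) := by gcongr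
    _ = γ⁻¹ * MQ * (γ * μQ ^ 2 / MT ^ 2)⁻¹ * ‖b‖ := by ring

variable {MD : ℝ} (hMD : 0 ≤ MD) (hD : ∀ s : S, ‖D s‖ ≤ MD * ‖s‖) (hDs : ∀ x : E, ‖Dstar x‖ ≤ MD * ‖x‖) (hR : ∀ s : S, ‖R s‖ ≤ ‖s‖)

include hγ hcoer hMT hMQ hμQ hQ hQadj hMD hD hDs hR in
/-- **`‖𝔊 x‖ ≤ γ⁻¹(1 + M_Q²·(M²/(γμ_Q²))·γ⁻¹ + M_D²·γ⁻¹)‖x‖`** for `𝔊 = G₁𝔓*`, `𝔓* = 1 − Q†(QG₁Q†)⁻¹QG₁ − DRD*G₁` ((110)–(111)/(3.153)).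
[cite: Balaban1985Variational, (110)–(111) p.294; Balaban1985BackgroundPropagators, (3.147) p.425, (3.153) p.426] -/
theorem norm_frakGLin_le (hMT0 : 0 < MT) (x : E) :
    ‖frakGLin (G1K Δ D R Dstar Q (LinearMap.adjoint Q) a hpos) Q (LinearMap.adjoint Q)
        (KinvK (Δ := Δ) (D := D) (R := R) (Dstar := Dstar) (Q := Q) (Qadj := LinearMap.adjoint Q) (a := a) hpos hadj hinj) D R Dstar x‖ ≤
      γ⁻¹ * (1 + MQ * (γ * μQ ^ 2 / MT ^ 2)⁻¹ * MQ * γ⁻¹ + MD * MD * γ⁻¹) * ‖x‖ := by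
  have hG : ∀ z : E, ‖G1K Δ D R Dstar Q (LinearMap.adjoint Q) a hpos z‖ ≤ γ⁻¹ * ‖z‖ := fun z => by
    unfold G1K; exact norm_greenK_le hγ hcoer hpos z
  have hK0 : 0 ≤ (γ * μQ ^ 2 / MT ^ 2)⁻¹ := by positivity
  have hγ0 : 0 ≤ γ⁻¹ := by positivity
  rw [frakGLin, LinearMap.comp_apply]
  refine (hG _).trans ?_
  -- `𝔓*x = x − Q†(Kinv(Q(G₁x))) − D(R(D*(G₁x)))`
  have hPstar : frakPstarLin (G1K Δ D R Dstar Q (LinearMap.adjoint Q) a hpos) Q (LinearMap.adjoint Q) (KinvK hpos hadj hinj) D R Dstar x =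
      x - LinearMap.adjoint Q (KinvK hpos hadj hinj (Q (G1K Δ D R Dstar Q (LinearMap.adjoint Q) a hpos x))) -
        D (R (Dstar (G1K Δ D R Dstar Q (LinearMap.adjoint Q) a hpos x))) := rfl
  rw [hPstar]
  have h1 : ‖LinearMap.adjoint Q (KinvK hpos hadj hinj (Q (G1K Δ D R Dstar Q (LinearMap.adjoint Q) a hpos x)))‖ ≤
      MQ * ((γ * μQ ^ 2 / MT ^ 2)⁻¹ * (MQ * (γ⁻¹ * ‖x‖))) := by
    refine (norm_adjoint_apply_le Q hMQ hQ _).trans (mul_le_mul_of_nonneg_left ?_ hMQ)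
    refine (norm_KinvK_le hγ hcoer hMT hpos hμQ hQadj hadj hinj hMT0 _).trans (mul_le_mul_of_nonneg_left ?_ hK0)
    exact (hQ _).trans (mul_le_mul_of_nonneg_left (hG x) hMQ)
  have h2 : ‖D (R (Dstar (G1K Δ D R Dstar Q (LinearMap.adjoint Q) a hpos x)))‖ ≤ MD * (MD * (γ⁻¹ * ‖x‖)) := by
    refine (hD _).trans (mul_le_mul_of_nonneg_left ((hR _).trans ?_) hMD)
    exact (hDs _).trans (mul_le_mul_of_nonneg_left (hG x) hMD)
  calc γ⁻¹ * ‖x - LinearMap.adjoint Q (KinvK hpos _ _ (Q (G1K Δ D R Dstar Q (LinearMap.adjoint Q) a hpos x))) -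
          D (R (Dstar (G1K Δ D R Dstar Q (LinearMap.adjoint Q) a hpos x)))‖
      ≤ γ⁻¹ * (‖x‖ + MQ * ((γ * μQ ^ 2 / MT ^ 2)⁻¹ * (MQ * (γ⁻¹ * ‖x‖))) + MD * (MD * (γ⁻¹ * ‖x‖))) := by
        refine mul_le_mul_of_nonneg_left ?_ hγ0
        calc _ ≤ ‖x - LinearMap.adjoint Q (KinvK hpos _ _ (Q (G1K Δ D R Dstar Q (LinearMap.adjoint Q) a hpos x)))‖ +
              ‖D (R (Dstar (G1K Δ D R Dstar Q (LinearMap.adjoint Q) a hpos x)))‖ := norm_sub_le _ _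
          _ ≤ (‖x‖ + ‖LinearMap.adjoint Q (KinvK hpos _ _ (Q (G1K Δ D R Dstar Q (LinearMap.adjoint Q) a hpos x)))‖) +
              ‖D (R (Dstar (G1K Δ D R Dstar Q (LinearMap.adjoint Q) a hpos x)))‖ := add_le_add (norm_sub_le _ _) le_rfl
          _ ≤ _ := add_le_add (add_le_add le_rfl h1) h2
    _ = γ⁻¹ * (1 + MQ * (γ * μQ ^ 2 / MT ^ 2)⁻¹ * MQ * γ⁻¹ + MD * MD * γ⁻¹) * ‖x‖ := by ring

end Abstract

/-! ## §2 An injective linear map on a finite-dimensional space has a modulus -/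

section Modulus

variable {𝕜 : Type*} [RCLike 𝕜] {E : Type*} [NormedAddCommGroup E] [InnerProductSpace 𝕜 E]
  {F : Type*} [NormedAddCommGroup F] [InnerProductSpace 𝕜 F] [FiniteDimensional 𝕜 F]

/-- **an injective linear map on a finite-dimensional space has a modulus `μ > 0`** (`μ‖y‖ ≤ ‖Ty‖`; compact unit sphere) — at the chain's letters:
`Q(1)` onto ⇒ `Q(1)†` injective ⇒ a modulus of `Q(1)†`, a finite-lattice number. [folklore] [cite: Balaban1985BackgroundPropagators, (3.19) p.393; Balaban1984PropagatorsI, p.25] -/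
theorem exists_modulus_of_injective (T : F →ₗ[𝕜] E) (hinj : Function.Injective T) : ∃ μ : ℝ, 0 < μ ∧ ∀ y : F, μ * ‖y‖ ≤ ‖T y‖ := by
  haveI : ProperSpace F := FiniteDimensional.proper_rclike 𝕜 F
  have hcont : Continuous fun y : F => ‖T y‖ := continuous_norm.comp T.continuous_of_finiteDimensional
  have hunit : ∀ y : F, y ≠ 0 → ((‖y‖⁻¹ : ℝ) : 𝕜) • y ∈ Metric.sphere (0 : F) 1 := fun y hy => by
    have hyn : 0 < ‖y‖ := norm_pos_iff.2 hy
    rw [mem_sphere_zero_iff_norm, norm_smul, RCLike.norm_ofReal, abs_of_pos (inv_pos.2 hyn), inv_mul_cancel₀ hyn.ne']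
  by_cases hne : (Metric.sphere (0 : F) 1).Nonempty
  · obtain ⟨u, hu, hmin⟩ := (isCompact_sphere (0 : F) 1).exists_isMinOn hne hcont.continuousOn
    have hu1 : ‖u‖ = 1 := mem_sphere_zero_iff_norm.1 hu
    have hu0 : u ≠ 0 := by rw [← norm_ne_zero_iff, hu1]; exact one_ne_zero
    have hμ : 0 < ‖T u‖ := by
      rw [norm_pos_iff]; exact fun h => hu0 (hinj (by rw [h, map_zero]))
    refine ⟨‖T u‖, hμ, fun y => ?_⟩
    by_cases hy : y = 0
    · rw [hy, norm_zero, mul_zero]; exact norm_nonneg _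
    · have hyn : 0 < ‖y‖ := norm_pos_iff.2 hy
      have hle : ‖T u‖ ≤ ‖T (((‖y‖⁻¹ : ℝ) : 𝕜) • y)‖ := hmin (hunit y hy)
      rw [map_smul, norm_smul, RCLike.norm_ofReal, abs_of_pos (inv_pos.2 hyn)] at hle
      rwa [← div_eq_inv_mul, le_div_iff₀ hyn] at hle
  · refine ⟨1, one_pos, fun y => ?_⟩
    by_cases hy : y = 0
    · rw [hy, norm_zero, mul_zero]; exact norm_nonneg _
    · exact absurd ⟨_, hunit y hy⟩ hne

end Modulus

end Literature.MathematicalPhysics.QuantumFieldTheory.Balaban1983to89.B9Eq3126GreenLetters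

end
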